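import Mathlib.FieldTheory.IsAlgClosed.AlgebraicClosure
import Mathlib.FieldTheory.IntermediateField.Adjoin.Algebra
import Mathlib.RingTheory.EssentialFiniteness
import Literature.AnabelianGeometry.AbsoluteAnabelian.AbsTopIII.KummerFaithful
import HarnessLib

/-!
# Finite extensions of (generalized) sub-`p`-adic fields are (generalized) sub-`p`-adic

Proof-only companion to `AbsTopIII/KummerFaithful.lean` (the cell's REAL definitions
`AbsTopIII.IsSubpadicFor` / `IsSubpadic` / `IsGeneralizedSubpadicFor` of [pGC] Def 15.4 (i) p. 77 and
[Tpcs] Def 4.11 p. 44): if `k` embeds into a finitely generated extension of a base field `B` and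
`F/k` is a finite extension, then `F` embeds into a finitely generated extension of `B`
(`exists_fg_extension_of_finite`).  This is the step "since [as one verifies immediately] any finite
extension of `k` satisfies the same hypotheses as `k`" used throughout [pGC] §15 and [AbsTopIII] §1
(e.g. Rmk 1.5.3 (i) p. 33, and the passage from [pGC] Lem 15.8 "center-free" to "slim" quoted in
[AbsTopI] Ex 4.8 (ii) p. 58).  No new definitions. [cite: MochizukiLocAn1999, Def 15.4 (i) p.77]
-/

universe u v

namespace Literature.AnabelianGeometry.AbsoluteAnabelian.AbsTopIII

open IntermediateField

/-- If `k` maps into a finitely generated field extension `L` of `B` and `F ⊇ k` is a finite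
extension, then `F` maps into a finitely generated field extension of `B` (namely `L(F)` inside an
algebraic closure of `L`).  The common step behind "finite extensions of sub-`p`-adic fields are
sub-`p`-adic" ([pGC] Def 15.4 (i) p. 77, examples (1)–(2)). [cite: MochizukiLocAn1999, Def 15.4 (i) p.77] -/
theorem exists_fg_extension_of_finite {B : Type} [Field B] {k : Type u} [Field k] {F : Type v}
    [Field F] [Algebra k F] [Module.Finite k F]
    (h : ∃ (L : Type) (_ : Field L) (_ : Algebra B L),
      (⊤ : IntermediateField B L).FG ∧ Nonempty (k →+* L)) :
    ∃ (L' : Type) (_ : Field L') (_ : Algebra B L'),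
      (⊤ : IntermediateField B L').FG ∧ Nonempty (F →+* L') := by
  obtain ⟨L, _, _, hL, ⟨ι⟩⟩ := h
  -- work inside an algebraic closure `Ω` of `L`
  let Ω : Type := AlgebraicClosure L
  let φ : k →+* Ω := (algebraMap L Ω).comp ι
  letI : Algebra k Ω := φ.toAlgebra
  haveI : Algebra.IsAlgebraic k F := Algebra.IsAlgebraic.of_finite k F
  -- lift the embedding of `k` to `F`
  let ψ : F →ₐ[k] Ω := IsAlgClosed.lift
  -- `L' := L(ψ(F))`, generated over `L` by the images of a `k`-basis of `F`
  classical
  let b := Module.Free.chooseBasis k F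
  let s : Finset Ω := (Finset.univ : Finset (Module.Free.ChooseBasisIndex k F)).image
    fun i => ψ (b i)
  let L' : IntermediateField L Ω := IntermediateField.adjoin L (s : Set Ω)
  have hψ : ∀ x : F, (ψ x : Ω) ∈ L' := by
    intro x
    rw [← b.sum_repr x, map_sum]
    refine sum_mem fun i _ => ?_
    rw [map_smul, Algebra.smul_def]
    refine mul_mem ?_ (IntermediateField.subset_adjoin L _ ?_)
    · -- scalars from `k` land in `L ⊆ L'`: `algebraMap k Ω = (algebraMap L Ω) ∘ ι`
      exact L'.algebraMap_mem (ι (b.repr x i))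
    · simp [s]
  -- `L'/L` is finite, hence `L'/B` is finitely generated
  haveI hfin : FiniteDimensional L L' := by
    refine IntermediateField.finiteDimensional_adjoin (S := (s : Set Ω)) fun x _ => ?_
    exact Algebra.IsIntegral.isIntegral x
  haveI : Algebra.EssFiniteType B L := IntermediateField.fg_top_iff.mp hL
  haveI : Algebra.EssFiniteType L L' := inferInstance
  haveI : Algebra.EssFiniteType B L' := Algebra.EssFiniteType.comp B L L'
  refine ⟨L', inferInstance, inferInstance, IntermediateField.fg_top_iff.mpr inferInstance,
    ⟨(ψ : F →+* Ω).codRestrict L' hψ⟩⟩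

/-- A finite extension of a sub-`p`-adic field is sub-`p`-adic ([pGC] Def 15.4 (i) p. 77; used
tacitly in [pGC] §15 and [AbsTopIII] §1). [cite: MochizukiLocAn1999, Def 15.4 (i) p.77] -/
theorem IsSubpadicFor.of_finite {k : Type u} [Field k] {F : Type v} [Field F] [Algebra k F]
    [Module.Finite k F] {p : ℕ} [Fact p.Prime] (h : IsSubpadicFor k p) : IsSubpadicFor F p :=
  ⟨exists_fg_extension_of_finite h.exists_embedding⟩

/-- A finite extension of a sub-`p`-adic field is sub-`p`-adic (prime-free form).
[cite: MochizukiLocAn1999, Def 15.4 (i) p.77] -/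
theorem IsSubpadic.of_finite {k : Type u} [Field k] {F : Type v} [Field F] [Algebra k F]
    [Module.Finite k F] (h : IsSubpadic k) : IsSubpadic F := by
  obtain ⟨p, hp, hk⟩ := h.exists_prime
  exact ⟨⟨p, hp, hk.of_finite⟩⟩

/-- A finite extension of a generalized sub-`p`-adic field is generalized sub-`p`-adic ([Tpcs]
Def 4.11 p. 44). [cite: MochizukiTopics2003, Def 4.11 p.44] -/
theorem IsGeneralizedSubpadicFor.of_finite {k : Type u} [Field k] {F : Type v} [Field F]
    [Algebra k F] [Module.Finite k F] {p : ℕ} [Fact p.Prime] (h : IsGeneralizedSubpadicFor k p) :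
    IsGeneralizedSubpadicFor F p :=
  ⟨exists_fg_extension_of_finite h.exists_embedding⟩

/-- A field that maps into a sub-`p`-adic field (e.g. a subfield) is sub-`p`-adic ([pGC] Def 15.4
(i) p. 77: "isomorphic to a subfield of"). [cite: MochizukiLocAn1999, Def 15.4 (i) p.77] -/
theorem IsSubpadicFor.of_ringHom {k : Type u} [Field k] {F : Type v} [Field F] (f : F →+* k)
    {p : ℕ} [Fact p.Prime] (h : IsSubpadicFor k p) : IsSubpadicFor F p := by
  obtain ⟨L, _, _, hL, ⟨ι⟩⟩ := h.exists_embedding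
  exact ⟨⟨L, inferInstance, inferInstance, hL, ⟨ι.comp f⟩⟩⟩

/-- A sub-`p`-adic field has characteristic zero. [cite: MochizukiLocAn1999, Def 15.4 (i) p.77] -/
theorem IsSubpadicFor.charZero {k : Type u} [Field k] {p : ℕ} [Fact p.Prime]
    (h : IsSubpadicFor k p) : CharZero k := by
  obtain ⟨L, _, _, _, ⟨ι⟩⟩ := h.exists_embedding
  haveI : CharZero L := charZero_of_injective_algebraMap (algebraMap ℚ_[p] L).injective
  exact ι.charZero

end Literature.AnabelianGeometry.AbsoluteAnabelian.AbsTopIII
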